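import Mathlib
import Summits.Ventures.PercRepro2.Defs
import Summits.Ventures.PercRepro2.Independence
import Summits.Ventures.PercRepro2.Harris
import Summits.Ventures.PercRepro2.Graph
import Summits.Ventures.PercRepro2.Events
import Summits.Ventures.PercRepro2.Induced
import Summits.Ventures.PercRepro2.BHKAvoid
import Summits.Ventures.PercRepro2.BHKEvents
import Summits.Ventures.PercRepro2.ZCPendantSecondOrder
import Summits.Ventures.PercRepro2.CDZero

/-!
# Row 2′CD and the `a₃`-required world: the exact identity and the conditional theorem
(blind cell PercRepro2, mine-a g31; MINE-A.md §86.1 (I2), §86.9)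

Two roots `a₁, a₂`, marks `a₃, o`; `Q = {a₁ ↮ a₂}`, `W = C₁ ∪ C₂`, `e = {a₃ ∈ C₁}`, `f = {o ∈ C₂}`,
`N = {a₃ ∉ W}`, `oU = {o ∈ W}`, `U = {C₁ ∈ 𝓔}` for an up-set `𝓔`.  Row 2′CD in cleared form is

  `(CD)   P(Q N oU) · (P(Q) P(Q U e) − P(Q U) P(Q e)) ≥ P(Q N) · (P(Q) P(Q U e f) − P(Q U) P(Q e f))`

(`γ·Cov_Q(U, e) ≥ Cov_Q(U, e f)` with `γ = P_Q(o ∈ W ∣ a₃ ∉ W)`, multiplied by `P(Q)²·P(Q N)`).  With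
`a = P(Q U e f)`, `b = P(Q U e)`, `c = P(Q e f)`, `d = P(Q e)`, `q = P(Q)`, `u = P(Q U)`, `n = P(Q N)`,
`m = P(Q N oU)` the EXACT identity

  `d · [m(qb − ud) − n(qa − uc)] = (qb − ud)(md − nc) + n q (bc − ad)`

(`cd_identity`) exhibits the row as: (PA boost `qb − ud ≥ 0`, BHK 1.3) × ((CD₀) slack `md − nc ≥ 0`,
`CDZero.cd_zero`) + `n q` × the `a₃`-REQUIRED cross covariance `bc − ad = P(Qe)²·Cov_{Q∩e}(U, f)`
with the sign reversed.  Hence (`cd_of_required_anticorr`) the row holds for every up-set `𝓔` whose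
event `U` is anti-correlated with `{o ∈ C₂}` in the `a₃`-required world, `P(QUef)P(Qe) ≤ P(QUe)P(Qef)`;
in particular (`cd_of_superset`) for every `𝓔` containing all vertex sets that contain `a₃`.  The
required-world covariance is positive on ≈ 2 % of random cells (MINE-A.md §86.1), so this is a
conditional theorem, not the row.  No definition; one seat.
-/

namespace Summit.Ventures.PercRepro2

namespace CDRequired

section Main

variable {V : Type*} {E : Type*} [Fintype E] [DecidableEq E] [Fintype V] [DecidableEq V]
  {R : Type*} [Field R] [LinearOrder R] [IsStrictOrderedRing R]

omit [LinearOrder R] [IsStrictOrderedRing R] in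
/-- The exact identity behind row 2′CD (pure algebra):
`d·[m(qb − ud) − n(qa − uc)] = (qb − ud)(md − nc) + n·q·(bc − ad)`. -/
theorem cd_identity (a b c d q u n m : R) :
    d * (m * (q * b - u * d) - n * (q * a - u * c)) =
      (q * b - u * d) * (m * d - n * c) + n * q * (b * c - a * d) := by
  ring

/-- **PA under `Q`** (BHK06 Thm 1.3 on the cluster of `a₁` avoiding `a₂`):
`P(Q ∩ U) · P(Q ∩ e) ≤ P(Q ∩ U ∩ e) · P(Q)`. -/
theorem pa_upset_e (p : E → R) (hp : IsProbVec p) (ends : E → Sym2 V) (a₁ a₂ a₃ : V)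
    {𝓔 : Set (Set V)} (h𝓔 : IsUpperSet 𝓔) :
    let Q := (connEvent ends a₁ a₂)ᶜ
    let U := clusterInEvent ends a₁ 𝓔
    let e := connEvent ends a₁ a₃
    prob p (Q ∩ U) * prob p (Q ∩ e) ≤ prob p (Q ∩ U ∩ e) * prob p Q := by
  intro Q U e
  have h := bhk_same_cluster_events p hp ends a₁ a₂ h𝓔 (ZCPendant.isUpperSet_mem_o (V := V) a₃)
  rw [ZCPendant.clusterInEvent_mem_o_eq] at h
  -- `h : P(U ∩ Q) * P(e ∩ Q) ≤ P(U ∩ e ∩ Q) * P(Q)`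
  have e1 : U ∩ Q = Q ∩ U := Set.inter_comm _ _
  have e2 : e ∩ Q = Q ∩ e := Set.inter_comm _ _
  have e3 : U ∩ e ∩ Q = Q ∩ U ∩ e := by
    ext ω; simp only [Set.mem_inter_iff]; tauto
  rw [e1, e2, e3] at h
  exact h

/-- **Row 2′CD under the `a₃`-required anti-correlation.** If `U = {C₁ ∈ 𝓔}` and `{o ∈ C₂}` are
negatively correlated given `Q ∩ {a₃ ∈ C₁}` (`P(QUef)·P(Qe) ≤ P(QUe)·P(Qef)`), then the row holds for
`𝓔`: `P(Q N)·(P(Q)P(QUef) − P(QU)P(Qef)) ≤ P(Q N oU)·(P(Q)P(QUe) − P(QU)P(Qe))`. -/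
theorem cd_of_required_anticorr (p : E → R) (hp : IsProbVec p) (ends : E → Sym2 V)
    (a₁ a₂ a₃ o : V) {𝓔 : Set (Set V)} (h𝓔 : IsUpperSet 𝓔)
    (hreq : prob p ((connEvent ends a₁ a₂)ᶜ ∩ clusterInEvent ends a₁ 𝓔 ∩ connEvent ends a₁ a₃ ∩
          connEvent ends a₂ o) * prob p ((connEvent ends a₁ a₂)ᶜ ∩ connEvent ends a₁ a₃) ≤
        prob p ((connEvent ends a₁ a₂)ᶜ ∩ clusterInEvent ends a₁ 𝓔 ∩ connEvent ends a₁ a₃) *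
          prob p ((connEvent ends a₁ a₂)ᶜ ∩ connEvent ends a₁ a₃ ∩ connEvent ends a₂ o)) :
    let Q := (connEvent ends a₁ a₂)ᶜ
    let U := clusterInEvent ends a₁ 𝓔
    let e := connEvent ends a₁ a₃
    let f := connEvent ends a₂ o
    let N := (connEvent ends a₁ a₃)ᶜ ∩ (connEvent ends a₂ a₃)ᶜ
    let oU := connEvent ends a₁ o ∪ connEvent ends a₂ o
    prob p (Q ∩ N) * (prob p Q * prob p (Q ∩ U ∩ e ∩ f) - prob p (Q ∩ U) * prob p (Q ∩ e ∩ f)) ≤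
      prob p (Q ∩ N ∩ oU) * (prob p Q * prob p (Q ∩ U ∩ e) - prob p (Q ∩ U) * prob p (Q ∩ e)) := by
  intro Q U e f N oU
  -- the three inputs
  have hPA := pa_upset_e p hp ends a₁ a₂ a₃ h𝓔
  have hCD0 := CDZero.cd_zero p hp ends a₁ a₂ a₃ o
  simp only at hPA hCD0
  -- `hPA : P(Q U) * P(Q e) ≤ P(Q U e) * P(Q)`, `hCD0 : P(Q e f) * P(Q N) ≤ P(Q e) * P(Q N oU)`
  set a := prob p (Q ∩ U ∩ e ∩ f) with ha
  set b := prob p (Q ∩ U ∩ e) with hb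
  set c := prob p (Q ∩ e ∩ f) with hc
  set d := prob p (Q ∩ e) with hd
  set q := prob p Q with hq
  set u := prob p (Q ∩ U) with hu
  set n := prob p (Q ∩ N) with hn
  set m := prob p (Q ∩ N ∩ oU) with hm
  have hreq' : a * d ≤ b * c := hreq
  have hPA' : u * d ≤ b * q := hPA
  have hCD0' : c * n ≤ d * m := hCD0
  have hd0 : 0 ≤ d := prob_nonneg hp _
  have hn0 : 0 ≤ n := prob_nonneg hp _
  have hq0 : 0 ≤ q := prob_nonneg hp _
  have hm0 : 0 ≤ m := prob_nonneg hp _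
  have hu0 : 0 ≤ u := prob_nonneg hp _
  have hbd : b ≤ d := prob_mono hp (Set.inter_subset_inter_left _ Set.inter_subset_left)
  have hab : a ≤ b := prob_mono hp Set.inter_subset_left
  have hcd : c ≤ d := prob_mono hp Set.inter_subset_left
  have hb0 : 0 ≤ b := prob_nonneg hp _
  have ha0 : 0 ≤ a := prob_nonneg hp _
  have hc0 : 0 ≤ c := prob_nonneg hp _
  rcases hd0.lt_or_eq with hdpos | hdzero
  · -- `d · [m(qb − ud) − n(qa − uc)] = (qb − ud)(md − nc) + n q (bc − ad) ≥ 0`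
    have key : d * (n * (q * a - u * c)) ≤ d * (m * (q * b - u * d)) := by
      have h1 : 0 ≤ (q * b - u * d) * (m * d - n * c) :=
        mul_nonneg (by linarith) (by linarith)
      have h2 : 0 ≤ n * q * (b * c - a * d) := mul_nonneg (mul_nonneg hn0 hq0) (by linarith)
      nlinarith [cd_identity a b c d q u n m, h1, h2]
    exact le_of_mul_le_mul_left key hdpos
  · -- `P(Q e) = 0` forces `a = b = c = 0`
    have hb' : b = 0 := le_antisymm (hdzero ▸ hbd) hb0
    have ha' : a = 0 := le_antisymm (hb' ▸ hab) ha0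
    have hc' : c = 0 := le_antisymm (hdzero ▸ hcd) hc0
    rw [ha', hb', hc', ← hdzero]
    simp

/-- Row 2′CD for every up-set `𝓔` that contains all vertex sets containing `a₃` (then `U ∩ e = e` and
the required-world hypothesis holds with equality). -/
theorem cd_of_superset (p : E → R) (hp : IsProbVec p) (ends : E → Sym2 V) (a₁ a₂ a₃ o : V)
    {𝓔 : Set (Set V)} (h𝓔 : IsUpperSet 𝓔) (hsup : {W : Set V | a₃ ∈ W} ⊆ 𝓔) :
    let Q := (connEvent ends a₁ a₂)ᶜ
    let U := clusterInEvent ends a₁ 𝓔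
    let e := connEvent ends a₁ a₃
    let f := connEvent ends a₂ o
    let N := (connEvent ends a₁ a₃)ᶜ ∩ (connEvent ends a₂ a₃)ᶜ
    let oU := connEvent ends a₁ o ∪ connEvent ends a₂ o
    prob p (Q ∩ N) * (prob p Q * prob p (Q ∩ U ∩ e ∩ f) - prob p (Q ∩ U) * prob p (Q ∩ e ∩ f)) ≤
      prob p (Q ∩ N ∩ oU) * (prob p Q * prob p (Q ∩ U ∩ e) - prob p (Q ∩ U) * prob p (Q ∩ e)) := by
  intro Q U e f N oU
  have hUe : Q ∩ U ∩ e = Q ∩ e := by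
    ext ω
    simp only [U, e, Set.mem_inter_iff, mem_clusterInEvent, mem_connEvent]
    constructor
    · rintro ⟨⟨h1, _⟩, h3⟩
      exact ⟨h1, h3⟩
    · rintro ⟨h1, h3⟩
      refine ⟨⟨h1, hsup ?_⟩, h3⟩
      simpa [mem_cluster] using h3
  refine cd_of_required_anticorr p hp ends a₁ a₂ a₃ o h𝓔 ?_
  show prob p (Q ∩ U ∩ e ∩ f) * prob p (Q ∩ e) ≤ prob p (Q ∩ U ∩ e) * prob p (Q ∩ e ∩ f)
  rw [hUe]
  exact le_of_eq (mul_comm _ _)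

end Main

end CDRequired

end Summit.Ventures.PercRepro2
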